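import Mathlib
import HarnessLib

/-!
# Crux `MarginalStabilityChain.StrainedLayerLaw` (stmt-AnomalousDissipation-3007), line `FirstLemmasR2K4`
# (parallel relaxation of `x`-independent perturbations): RELAXATION TOOLS (registered stub
# `stub_parallelRelaxTools`)

Support file (`--supports stmt-AnomalousDissipation-3007`). Four definition-free real-analysis tools of the
parallel-relaxation package (the lead's checked skeleton `ParallelRelax`, stub E). In the package the dissipation
slice of the parallel member is `ν ∫ (a + b_t)²` with `a = U_B′` fixed in `L²` and
`b_t(y) = eᵗ h_t′(eᵗ y)`, `‖b_t‖₂² = eᵗ ‖h_t′‖₂² ≤ C eᵗ s(t)^{-3/2} → 0`, `s(t) = ν (e^{2t} − 1) / 2`; the tools are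
the generic plumbing of that computation:

* §1 a compactly supported function tends to `0` at `±∞` (`tendsto_zero_atTop_atBot_of_hasCompactSupport`);
* §2 the `L²` algebra of a perturbed square: `(a + b)²` is integrable, `∫ (a + b)² ≤ 2 ∫ a² + 2 ∫ b²`, and the
  `δ`-trick `|∫ (a + b)² − ∫ a²| ≤ δ ∫ a² + (1 + 1/δ) ∫ b²` (`sq_add_integral_bounds`), from the pointwise
  `|(p + q)² − p²| ≤ δ p² + (1 + 1/δ) q²` (`abs_sq_add_sub_sq_le`);
* §3 the `L²` scaling `∫ (c f(c y))² dy = c ∫ f²` for `c > 0` (`integral_sq_scale`);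
* §4 the clock decay `eᵗ (ν (e^{2t} − 1) / 2)^{-3/2} → 0` (`tendsto_exp_mul_clock_rpow`).

No definitions; the registered stub `stub_parallelRelaxTools` (the conjunction of §1–§4) closes the file.
All integrals are over `ℝ` with respect to Lebesgue measure.
-/

noncomputable section

open scoped Topology
open Filter Set MeasureTheory

-- `Summit.<Summit>.<Problem>` is the tree's mandated summit-side namespace (CONVENTIONS §2); for this
-- single-conjunct summit the two coincide, so the duplicate is deliberate.
set_option linter.dupNamespace false

namespace Summit.AnomalousDissipation.AnomalousDissipation.Theorems.StrainedLayerLaw.ParallelRelax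

/-! ## §1 Compactly supported functions vanish at `±∞` -/

/-- **A compactly supported function tends to `0` at `±∞`.** If `g : ℝ → ℝ` has compact support, its
topological support lies in some `closedBall 0 ρ`, so `g y = 0` for `ρ < |y|`, whence `g → 0` along `atTop` and
`atBot`. [folklore] -/
theorem tendsto_zero_atTop_atBot_of_hasCompactSupport (g : ℝ → ℝ) (hc : HasCompactSupport g) :
    Tendsto g atTop (𝓝 0) ∧ Tendsto g atBot (𝓝 0) := by
  obtain ⟨ρ, hρ⟩ := hc.isCompact.isBounded.subset_closedBall 0
  have hz : ∀ y, ρ < |y| → g y = 0 := fun y hy =>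
    image_eq_zero_of_notMem_tsupport fun h => by
      have := mem_closedBall_zero_iff.1 (hρ h)
      rw [Real.norm_eq_abs] at this
      linarith
  constructor
  · refine tendsto_const_nhds.congr' ?_
    filter_upwards [eventually_gt_atTop ρ] with y hy
    exact (hz y (hy.trans_le (le_abs_self y))).symm
  · refine tendsto_const_nhds.congr' ?_
    filter_upwards [eventually_lt_atBot (-ρ)] with y hy
    refine (hz y ?_).symm
    have : ρ < -y := by linarith
    exact this.trans_le (neg_le_abs y)

/-! ## §2 The `L²` algebra of a perturbed square -/

/-- **The pointwise `δ`-trick.** For `δ > 0` and reals `p q`,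
`|(p + q)² − p²| = |2pq + q²| ≤ δ p² + (1 + 1/δ) q²`, since `2|pq| ≤ δ p² + q²/δ`. [folklore] -/
theorem abs_sq_add_sub_sq_le (p q δ : ℝ) (hδ : 0 < δ) :
    |(p + q) ^ 2 - p ^ 2| ≤ δ * p ^ 2 + (1 + 1 / δ) * q ^ 2 := by
  obtain ⟨c, rfl⟩ : ∃ c, q = δ * c := ⟨q / δ, by field_simp⟩
  have h1 : (1 + 1 / δ) * (δ * c) ^ 2 = δ ^ 2 * c ^ 2 + δ * c ^ 2 := by
    field_simp
  rw [h1, abs_le]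
  constructor
  · nlinarith [mul_nonneg hδ.le (sq_nonneg (p + c)), sq_nonneg (δ * c)]
  · nlinarith [mul_nonneg hδ.le (sq_nonneg (p - c)), sq_nonneg (δ * c)]

/-- **`L²` bounds for a perturbed square.** For continuous `a b : ℝ → ℝ` with `a²` and `b²` integrable and
`δ > 0`: `(a + b)²` is integrable (dominated by `2a² + 2b²`), `∫ (a + b)² ≤ 2 ∫ a² + 2 ∫ b²`, and
`|∫ (a + b)² − ∫ a²| ≤ δ ∫ a² + (1 + 1/δ) ∫ b²` (integrate `abs_sq_add_sub_sq_le`). [folklore] -/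
theorem sq_add_integral_bounds (a b : ℝ → ℝ) (δ : ℝ) (hδ : 0 < δ) (ha : Continuous a) (hb : Continuous b)
    (ha2 : Integrable (fun y => a y ^ 2)) (hb2 : Integrable (fun y => b y ^ 2)) :
    Integrable (fun y => (a y + b y) ^ 2) ∧
    ∫ y, (a y + b y) ^ 2 ≤ 2 * (∫ y, a y ^ 2) + 2 * (∫ y, b y ^ 2) ∧
    |(∫ y, (a y + b y) ^ 2) - ∫ y, a y ^ 2| ≤ δ * (∫ y, a y ^ 2) + (1 + 1 / δ) * (∫ y, b y ^ 2) := by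
  -- the crude majorant `2a² + 2b²`
  have hmaj : Integrable (fun y => 2 * a y ^ 2 + 2 * b y ^ 2) := (ha2.const_mul 2).add (hb2.const_mul 2)
  have hpt : ∀ y, (a y + b y) ^ 2 ≤ 2 * a y ^ 2 + 2 * b y ^ 2 := fun y => by
    nlinarith [sq_nonneg (a y - b y)]
  have hab : Integrable (fun y => (a y + b y) ^ 2) := by
    refine hmaj.mono' ((ha.add hb).pow 2).aestronglyMeasurable (Eventually.of_forall fun y => ?_)
    rw [Real.norm_eq_abs, abs_of_nonneg (sq_nonneg _)]
    exact hpt y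
  refine ⟨hab, ?_, ?_⟩
  · calc ∫ y, (a y + b y) ^ 2 ≤ ∫ y, (2 * a y ^ 2 + 2 * b y ^ 2) := integral_mono hab hmaj hpt
      _ = 2 * (∫ y, a y ^ 2) + 2 * (∫ y, b y ^ 2) := by
        rw [integral_add (ha2.const_mul 2) (hb2.const_mul 2), integral_const_mul, integral_const_mul]
  · have hdom : Integrable (fun y => δ * a y ^ 2 + (1 + 1 / δ) * b y ^ 2) :=
      (ha2.const_mul δ).add (hb2.const_mul _)
    rw [← integral_sub hab ha2, ← Real.norm_eq_abs]
    calc ‖∫ y, ((a y + b y) ^ 2 - a y ^ 2)‖ ≤ ∫ y, (δ * a y ^ 2 + (1 + 1 / δ) * b y ^ 2) :=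
          norm_integral_le_of_norm_le hdom (Eventually.of_forall fun y => by
            rw [Real.norm_eq_abs]
            exact abs_sq_add_sub_sq_le (a y) (b y) δ hδ)
      _ = δ * (∫ y, a y ^ 2) + (1 + 1 / δ) * (∫ y, b y ^ 2) := by
        rw [integral_add (ha2.const_mul δ) (hb2.const_mul _), integral_const_mul, integral_const_mul]

/-! ## §3 The `L²` scaling -/

/-- **`L²` scaling on the line.** For `c > 0` and `f²` integrable, `y ↦ (c f(c y))²` is integrable and
`∫ (c f(c y))² dy = c ∫ f²`: the substitution `z = c y` (`Measure.integral_comp_mul_left`) gives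
`∫ f(c y)² dy = c⁻¹ ∫ f²`, and `(c f)² = c² f²`. [folklore] -/
theorem integral_sq_scale (f : ℝ → ℝ) (c : ℝ) (hc : 0 < c) (hf : Integrable (fun y => f y ^ 2)) :
    Integrable (fun y => (c * f (c * y)) ^ 2) ∧ ∫ y, (c * f (c * y)) ^ 2 = c * ∫ y, f y ^ 2 := by
  have hfun : (fun y => (c * f (c * y)) ^ 2) = fun y => c ^ 2 * f (c * y) ^ 2 := by
    funext y
    ring
  have hcomp : Integrable (fun y => f (c * y) ^ 2) := hf.comp_mul_left' hc.ne'
  have hsub : ∫ y, f (c * y) ^ 2 = c⁻¹ * ∫ y, f y ^ 2 := by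
    have h := Measure.integral_comp_mul_left (fun z => f z ^ 2) c
    rwa [smul_eq_mul, abs_of_pos (inv_pos.2 hc)] at h
  rw [hfun]
  refine ⟨hcomp.const_mul (c ^ 2), ?_⟩
  rw [integral_const_mul, hsub, ← mul_assoc, pow_two, mul_assoc c c, mul_inv_cancel₀ hc.ne', mul_one]

/-! ## §4 The clock decay -/

/-- **The clock decay.** For `ν > 0`, `eᵗ (ν (e^{2t} − 1) / 2)^{-3/2} → 0` as `t → +∞`: for `t ≥ 1` one has
`e^{2t} ≥ 3`, so `ν (e^{2t} − 1)/2 ≥ (ν/4) e^{2t}` and, the exponent being negative,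
`0 ≤ eᵗ (ν (e^{2t} − 1)/2)^{-3/2} ≤ eᵗ (ν/4)^{-3/2} e^{-3t} = (ν/4)^{-3/2} e^{-2t} → 0`. [folklore] -/
theorem tendsto_exp_mul_clock_rpow (ν : ℝ) (hν : 0 < ν) :
    Tendsto (fun t : ℝ => Real.exp t * (ν * (Real.exp (2 * t) - 1) / 2) ^ (-(3 / 2 : ℝ))) atTop (𝓝 0) := by
  -- the majorant `(ν/4)^{-3/2} e^{-2t} → 0`
  have h2 : Tendsto (fun t : ℝ => Real.exp (-(2 * t))) atTop (𝓝 0) :=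
    Real.tendsto_exp_neg_atTop_nhds_zero.comp (tendsto_id.const_mul_atTop two_pos)
  have hmaj : Tendsto (fun t : ℝ => (ν / 4) ^ (-(3 / 2 : ℝ)) * Real.exp (-(2 * t))) atTop (𝓝 0) := by
    simpa using h2.const_mul ((ν / 4) ^ (-(3 / 2 : ℝ)))
  -- the two-sided estimate for `t ≥ 1`
  have hkey : ∀ t : ℝ, 1 ≤ t →
      0 ≤ Real.exp t * (ν * (Real.exp (2 * t) - 1) / 2) ^ (-(3 / 2 : ℝ)) ∧
      Real.exp t * (ν * (Real.exp (2 * t) - 1) / 2) ^ (-(3 / 2 : ℝ)) ≤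
        (ν / 4) ^ (-(3 / 2 : ℝ)) * Real.exp (-(2 * t)) := fun t ht => by
    have hE : (3 : ℝ) ≤ Real.exp (2 * t) := by
      have h1 := Real.add_one_le_exp (2 : ℝ)
      have h2 : Real.exp 2 ≤ Real.exp (2 * t) := Real.exp_le_exp.2 (by linarith)
      linarith
    have hlow : ν / 4 * Real.exp (2 * t) ≤ ν * (Real.exp (2 * t) - 1) / 2 := by
      have : 0 ≤ ν * (Real.exp (2 * t) - 2) := mul_nonneg hν.le (by linarith)
      linarith
    have hpos : 0 < ν / 4 * Real.exp (2 * t) := by positivity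
    have hrpow : (ν * (Real.exp (2 * t) - 1) / 2) ^ (-(3 / 2 : ℝ)) ≤ (ν / 4 * Real.exp (2 * t)) ^ (-(3 / 2 : ℝ)) :=
      Real.rpow_le_rpow_of_nonpos hpos hlow (by norm_num)
    have hsplit : (ν / 4 * Real.exp (2 * t)) ^ (-(3 / 2 : ℝ)) = (ν / 4) ^ (-(3 / 2 : ℝ)) * Real.exp (-(3 * t)) := by
      rw [Real.mul_rpow (by positivity) (Real.exp_pos _).le, ← Real.exp_mul]
      congr 2
      ring
    refine ⟨mul_nonneg (Real.exp_pos t).le (Real.rpow_nonneg (hpos.le.trans hlow) _), ?_⟩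
    calc Real.exp t * (ν * (Real.exp (2 * t) - 1) / 2) ^ (-(3 / 2 : ℝ))
        ≤ Real.exp t * ((ν / 4) ^ (-(3 / 2 : ℝ)) * Real.exp (-(3 * t))) :=
          mul_le_mul_of_nonneg_left (hrpow.trans_eq hsplit) (Real.exp_pos t).le
      _ = (ν / 4) ^ (-(3 / 2 : ℝ)) * Real.exp (-(2 * t)) := by
          have : Real.exp (-(2 * t)) = Real.exp t * Real.exp (-(3 * t)) := by
            rw [← Real.exp_add]
            congr 1
            ring
          rw [this]
          ring
  refine squeeze_zero' ?_ ?_ hmaj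
  · filter_upwards [eventually_ge_atTop (1 : ℝ)] with t ht using (hkey t ht).1
  · filter_upwards [eventually_ge_atTop (1 : ℝ)] with t ht using (hkey t ht).2

/-! ## The registered stub -/

/-- **Stub E of the parallel-relaxation package (`stub_parallelRelaxTools`).** The conjunction of
`tendsto_zero_atTop_atBot_of_hasCompactSupport` (compact support forces `g → 0` at `±∞`),
`sq_add_integral_bounds` (`(a+b)²` integrable, `∫ (a+b)² ≤ 2∫a² + 2∫b²`, and the `δ`-trick
`|∫ (a+b)² − ∫ a²| ≤ δ ∫ a² + (1 + 1/δ) ∫ b²`), `integral_sq_scale` (`∫ (c f(c y))² dy = c ∫ f²`, `c > 0`) and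
`tendsto_exp_mul_clock_rpow` (`eᵗ (ν (e^{2t} − 1)/2)^{-3/2} → 0`). [folklore] -/
theorem stub_parallelRelaxTools :
    (∀ (g : ℝ → ℝ), HasCompactSupport g → Tendsto g atTop (𝓝 0) ∧ Tendsto g atBot (𝓝 0)) ∧
    (∀ (a b : ℝ → ℝ) (δ : ℝ), 0 < δ → Continuous a → Continuous b →
      Integrable (fun y => a y ^ 2) → Integrable (fun y => b y ^ 2) →
        Integrable (fun y => (a y + b y) ^ 2) ∧
        ∫ y, (a y + b y) ^ 2 ≤ 2 * (∫ y, a y ^ 2) + 2 * (∫ y, b y ^ 2) ∧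
        |(∫ y, (a y + b y) ^ 2) - ∫ y, a y ^ 2| ≤ δ * (∫ y, a y ^ 2) + (1 + 1 / δ) * (∫ y, b y ^ 2)) ∧
    (∀ (f : ℝ → ℝ) (c : ℝ), 0 < c → Integrable (fun y => f y ^ 2) →
      Integrable (fun y => (c * f (c * y)) ^ 2) ∧ ∫ y, (c * f (c * y)) ^ 2 = c * ∫ y, f y ^ 2) ∧
    (∀ (ν : ℝ), 0 < ν →
      Tendsto (fun t : ℝ => Real.exp t * (ν * (Real.exp (2 * t) - 1) / 2) ^ (-(3 / 2 : ℝ))) atTop (𝓝 0)) :=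
  ⟨tendsto_zero_atTop_atBot_of_hasCompactSupport, sq_add_integral_bounds, integral_sq_scale,
    tendsto_exp_mul_clock_rpow⟩

end Summit.AnomalousDissipation.AnomalousDissipation.Theorems.StrainedLayerLaw.ParallelRelax
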